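/- Copyright: the b2b-balaban cell (near-miss cell 7), T⁴-continuum fan-out, ROUND-2 swarm of lineage t4-ne7b-p1
(node U5c COUNT member), seat t4-ne7b-formalise-leaf-04.  Released under the licence of the surrounding project. -/
import Summits.QuantumFields.BalabanUV.T4Continuum.Support.HistoryConstants
import Summits.QuantumFields.BalabanUV.T4Continuum.Support.HistoryConstantsExist

/-!
# History constants, the bridge S9 ↔ S10: the print-shaped record, `Dominates ⇒ Refines`, the product step

Summits-side support leaf of the T⁴-continuum cell (rung (B)+1 on a FINITE torus only; NOT infinite volume, NOT the
mass gap, NOT the Clay statement; NOT a proof of the spine estimate NE7b).  Claim table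
`t4/b2b-balaban-t4-ne7b-p1/LEAVES-NE7b.md`, junction of rows S9 (`HistoryConstants`: print's displayed constants
`PrintedO1s`, the constants junction `Dominates C O`) and S10 (`HistoryConstantsExist`: the socket is monotone along
`Refines C Cp`, free margins, `ThresholdOK`), answering the S10 holder's interface request (cell journal «Q NE7b-S9»,
2026-08-20).  [folklore] real arithmetic and finite products over the lineage's own carrier; nothing is quoted from
print beyond what `HistoryConstants` locates, nothing printed is asserted, no `Prop`-valued fact of Bałaban's is
minted, no constant is specialised to a numeral (trigger conditions c1∕c2∕c6).

WHAT.  §1 **`printedConsts O C`** — THE MINIMAL PRINT-SHAPED RECORD of symbolic constants over the grid ∕ profile ∕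
margins of `C` (`n₁ κ₁ E₀ Eb μ A₀ p₀` taken from `C`; window power `d+1`, connector class `2d`, birth constant `½γ₀A₁²`,
floor `max (o80·M^d·64^d) (o88·(100M)^d)`, size `max (o81·M^d·3(126)^d) (2·o87·M^d)` from `O`), with
`dominates_printedConsts : O.Pos → Dominates (printedConsts O C) O`, validity and `ThresholdOK` under the displayed side
conditions (margins `≥ 0`, `fatWait (2d) ≤ n₁`, `0 < A₀`, `1 ≤ L`, `0 ≤ β₀`, and print's ledger item R9 = the cell's
(X7) `r·(d+2) < p₀`).  §2 **`Dominates.refines_printedConsts : Dominates C O → O.Pos → 0 ≤ C.A₀ → Refines C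
(printedConsts O C)`** — every record dominating print's displayed entries refines the minimal one, so S10's transfers
apply (`HistoryConstantsExist.liveHistories_of_refines`; for the TAGGED socket of ruling R-T,
`HistoryConstantsExistTagged.liveHistoriesT_of_refines`, filed by the S10 holder).  §3 THE PRODUCT STEP FROM PRINT-PRICED
FACTORS: `pshape` = zone∕partner prefactor × `e^{−credits (pcredit O C g) G}·e^{+lifeCost W κ G}` for a realised per-step
cost `κ` READ below the model's `cost` on the life (reading (ID-a), displayed by the consumer),
`Dominates.pshape_le_shapeZ`, and **`Dominates.le_prod_shapeZ`**: a class price below a product of print-priced factors —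
over any finite family of live structures, e.g. the (root cell, genealogy) pairs of the tagged socket with `gen = Prod.snd`
— is below the product of the model's `shapeZ`: the `price`∕`price'` fields at `C`.  §4 sanity on the toy pair of
`HistoryConstants`.

USE (row S12).  Either (a) fill the socket at any `C` with `Dominates C O` — `price` by `le_prod_shapeZ` from the
displayed H3 bound — taking `C := printedConsts O C'` to get `ThresholdOK` by `thresholdOK_printedConsts`; or (b) fill it
at `printedConsts O C` and move to any refinement by the S10 transfers.

HONEST.  Bookkeeping between two typed interfaces of the same lineage; discharges nothing of H3 ∕ (ID-a) ∕ (B) ∕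
BetaPertH.  NE7b NOT proved; spine 0∕9.  HONEST DEPENDENCY (cell): continuum YM on T⁴ ⇐ BetaPertH ∧ nine spine
estimates (0/9 proved); BetaPertH ⇐ (D1) ∧ (D4) ∧ CAP+tail; G-an2-4 gates asym, D1 and NE2/3/4.
-/

open Finset
open Literature.MathematicalPhysics.QuantumFieldTheory.Balaban1983to89
open T4PersistenceDictionary T4PersistentHistoryCount T4BankedInduction T4PrintedShapeBanking T4PartnerMultiplicity
open Summit.QuantumFields.BalabanUV.T4Continuum.Crowding
open Summit.QuantumFields.BalabanUV.T4Continuum.PartnerMultiplicityF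
open Summit.QuantumFields.BalabanUV.T4Continuum.CountThresholdUniform
open Summit.QuantumFields.BalabanUV.T4Continuum.HistorySocket
open Summit.QuantumFields.BalabanUV.T4Continuum.HistoryConstantsExist

namespace Summit.QuantumFields.BalabanUV.T4Continuum.HistoryConstants

noncomputable section

/-! ## §1 The minimal print-shaped record of symbolic constants -/

/-- **THE PRINT-SHAPED RECORD** of `O` over the grid ∕ profile ∕ margins of `C`: merger allowance, bank rate, margins,
profile amplitude and exponent FROM `C` (free parameters of the count carrier and of the profile rendering); window
power `d + 1`, connector class `2d`, birth constant `½γ₀A₁²`, floor constant `max (o80·M^d·64^d) (o88·(100M)^d)`, size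
constant `max (o81·M^d·3(126)^d) (2·o87·M^d)` FROM PRINT's displayed entries (the least values the six inequalities of
`Dominates` allow). [folklore] -/
def printedConsts (O : PrintedO1s) (C : T4PrintedShapeBanking.Consts) : T4PrintedShapeBanking.Consts where
  n₁ := C.n₁
  dC := 2 * O.d
  q' := O.d + 1
  E₂ := max (O.o80 * O.M ^ O.d * 64 ^ O.d) (O.o88 * (100 * O.M) ^ O.d)
  E₃ := max (O.o81 * O.M ^ O.d * (3 * 126 ^ O.d)) (2 * O.o87 * O.M ^ O.d)
  κ₁ := C.κ₁
  E₀ := C.E₀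
  Eb := C.Eb
  μ := C.μ
  a := O.γ₀ * O.A₁ ^ 2 / 2
  A₀ := C.A₀
  p₀ := C.p₀

section Record

variable (O : PrintedO1s) (C : T4PrintedShapeBanking.Consts)

/-- grid: the merger allowance is `C`'s [folklore] -/
@[simp] theorem printedConsts_n₁ : (printedConsts O C).n₁ = C.n₁ := rfl
/-- connector class `2d` [folklore] -/
@[simp] theorem printedConsts_dC : (printedConsts O C).dC = 2 * O.d := rfl
/-- window power `d + 1` [folklore] -/
@[simp] theorem printedConsts_q' : (printedConsts O C).q' = O.d + 1 := rfl
/-- floor constant [folklore] -/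
@[simp] theorem printedConsts_E₂ :
    (printedConsts O C).E₂ = max (O.o80 * O.M ^ O.d * 64 ^ O.d) (O.o88 * (100 * O.M) ^ O.d) := rfl
/-- size constant [folklore] -/
@[simp] theorem printedConsts_E₃ :
    (printedConsts O C).E₃ = max (O.o81 * O.M ^ O.d * (3 * 126 ^ O.d)) (2 * O.o87 * O.M ^ O.d) := rfl
/-- bank rate from `C` [folklore] -/
@[simp] theorem printedConsts_κ₁ : (printedConsts O C).κ₁ = C.κ₁ := rfl
/-- renewal∕merger margin from `C` [folklore] -/
@[simp] theorem printedConsts_E₀ : (printedConsts O C).E₀ = C.E₀ := rfl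
/-- birth margin base from `C` [folklore] -/
@[simp] theorem printedConsts_Eb : (printedConsts O C).Eb = C.Eb := rfl
/-- fatness margin from `C` [folklore] -/
@[simp] theorem printedConsts_μ : (printedConsts O C).μ = C.μ := rfl
/-- birth constant `½γ₀A₁²` [folklore] -/
@[simp] theorem printedConsts_a : (printedConsts O C).a = O.γ₀ * O.A₁ ^ 2 / 2 := rfl
/-- profile amplitude from `C` [folklore] -/
@[simp] theorem printedConsts_A₀ : (printedConsts O C).A₀ = C.A₀ := rfl
/-- profile exponent from `C` [folklore] -/
@[simp] theorem printedConsts_p₀ : (printedConsts O C).p₀ = C.p₀ := rfl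

variable {O}

/-- **THE PRINT-SHAPED RECORD DOMINATES PRINT's ENTRIES** (the six inequalities of `Dominates`, each with equality or by
`le_max_left∕right`; the surplus clause from `β₀ ≥ 0`). [folklore] -/
theorem dominates_printedConsts (hO : O.Pos) : Dominates (printedConsts O C) O where
  birth := le_of_eq rfl
  renewal P _ := le_rfl
  surplus P hP := surplus_le_of_nonneg hO.β₀_nonneg hP
  window := rfl
  floor := le_max_left _ _
  size := le_max_left _ _
  connClass := rfl
  connector := by
    have hM : 0 ≤ O.M ^ O.d := pow_nonneg hO.M_pos.le _
    have h87 := hO.o87_pos.le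
    have hd : (1 : ℝ) ≤ O.d := by exact_mod_cast hO.d_pos
    have hmax : 2 * O.o87 * O.M ^ O.d ≤ (printedConsts O C).E₃ := le_max_right _ _
    rw [printedConsts_dC]; push_cast
    nlinarith [mul_le_mul_of_nonneg_right hmax (show (0 : ℝ) ≤ O.d by linarith), mul_nonneg h87 hM]
  extension := le_max_right _ _

/-- the floor constant of the print-shaped record is nonnegative [folklore] -/
theorem printedConsts_E₂_nonneg (hO : O.Pos) : 0 ≤ (printedConsts O C).E₂ :=
  le_trans (by have := hO.o80_pos; have := hO.M_pos; positivity) (le_max_left _ _)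

/-- the size constant of the print-shaped record is nonnegative [folklore] -/
theorem printedConsts_E₃_nonneg (hO : O.Pos) : 0 ≤ (printedConsts O C).E₃ :=
  le_trans (by have := hO.o81_pos; have := hO.M_pos; positivity) (le_max_left _ _)

/-- the birth constant of the print-shaped record is positive [folklore] -/
theorem printedConsts_a_pos (hO : O.Pos) : 0 < (printedConsts O C).a := by
  have := hO.γ₀_pos; have := hO.A₁_pos; rw [printedConsts_a]; positivity

/-- **VALIDITY** of the print-shaped record: nonnegative margins of `C` and the connector epoch within the merger
allowance, `fatWait (2d) ≤ n₁`. [folklore] -/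
theorem printedConsts_valid (hO : O.Pos) (hκ : 0 ≤ C.κ₁) (hE₀ : 0 ≤ C.E₀) (hEb : 0 ≤ C.Eb) (hμ : 0 ≤ C.μ)
    (hn : fatWait (2 * O.d) ≤ C.n₁) : (printedConsts O C).Valid :=
  ⟨printedConsts_E₂_nonneg C hO, printedConsts_E₃_nonneg C hO, hκ, hE₀, hEb, hμ, hn⟩

/-- **`ThresholdOK` AT THE PRINT-SHAPED RECORD**: validity as above, `0 < A₀`, `1 ≤ L`, `0 ≤ β₀`, and print's ledger item
R9 ∕ the cell's (X7) at `q′ = d + 1`: `r·(d+2) < p₀`. [folklore] -/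
theorem thresholdOK_printedConsts (hO : O.Pos) (hκ : 0 ≤ C.κ₁) (hE₀ : 0 ≤ C.E₀) (hEb : 0 ≤ C.Eb) (hμ : 0 ≤ C.μ)
    (hn : fatWait (2 * O.d) ≤ C.n₁) (hA : 0 < C.A₀) {L r : ℕ} (hL : 1 ≤ L) {β₀ : ℝ} (hβ : 0 ≤ β₀)
    (hrq : r * (O.d + 2) < C.p₀) : ThresholdOK (printedConsts O C) L r β₀ :=
  ⟨printedConsts_valid C hO hκ hE₀ hEb hμ hn, printedConsts_a_pos C hO, hA, hL, hβ, hrq⟩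

end Record

/-! ## §2 `Dominates ⇒ Refines`: every dominating record refines the minimal print-shaped one -/

/-- **EVERY RECORD DOMINATING PRINT's ENTRIES REFINES THE PRINT-SHAPED RECORD** over its own grid ∕ profile ∕ margins
(so S10's `liveHistories_of_refines` and `HistoryConstantsExistTagged.liveHistoriesT_of_refines` apply): the
discrete data agree by the fields `window`, `connClass`; the profile is shared; `C.a·A₀² ≤ ½γ₀A₁²·A₀²`; the maxima are
below `C.E₂`, `C.E₃` by `floor`∕`extension` and `size`∕`connector` (the latter read at `dC = 2d`, `d ≥ 1`). [folklore] -/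
theorem Dominates.refines_printedConsts {C : T4PrintedShapeBanking.Consts} {O : PrintedO1s} (hD : Dominates C O)
    (hO : O.Pos) (hA : 0 ≤ C.A₀) : Refines C (printedConsts O C) where
  n₁_eq := rfl
  q'_eq := hD.window
  dC_eq := hD.connClass
  p₀_eq := rfl
  A₀_nonneg := hA
  A₀_le := le_rfl
  aA_le := by
    rw [printedConsts_a, printedConsts_A₀]
    exact mul_le_mul_of_nonneg_right hD.birth (by positivity)
  E₂_le := max_le hD.floor hD.extension
  E₃_le := by
    refine max_le hD.size ?_
    have h := hD.connector
    rw [hD.connClass] at h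
    push_cast at h
    have hd : (1 : ℝ) ≤ O.d := by exact_mod_cast hO.d_pos
    have hM : 0 ≤ O.M ^ O.d := pow_nonneg hO.M_pos.le _
    have hE : 0 ≤ C.E₃ := le_trans (by have := hO.o81_pos; positivity) hD.size
    -- `o87·2d·M^d ≤ E₃·2d·½ = E₃·d`, divide by `d ≥ 1`
    by_contra hlt
    rw [not_le] at hlt
    nlinarith [mul_lt_mul_of_pos_right hlt (show (0 : ℝ) < O.d by linarith), mul_nonneg hO.o87_pos.le hM]

/-! ## §3 The product step from print-priced factors -/

section Product

variable {C : T4PrintedShapeBanking.Consts} {O : PrintedO1s} {Kz p σ Λ' : ℝ}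

/-- **THE PRINT-PRICED LABELLED SHAPE** of a genealogy with a realised per-step cost `κ`: the zone∕partner prefactor of
`shapeZ` × `e^{−credits (pcredit O C g) G}` (PRINT's credits) × `e^{+lifeCost (dictW R C.n₁) κ G}`. [folklore] -/
def pshape (O : PrintedO1s) (C : T4PrintedShapeBanking.Consts) (Kz p σ Λ' : ℝ) (R : ℕ → ℕ) (g : ℕ → ℝ)
    (κ : Gen PEv → ℕ → ℝ) (G : Gen PEv) : ℝ :=
  Kz ^ (merges G).card * (∏ e ∈ merges G, Crowding.Q (wcnt G) σ e.step ^ p) * Λ' ^ partnerAges PEv.step G *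
    (Real.exp (-credits (pcredit O C g) G) * Real.exp (lifeCost (dictW R C.n₁) κ G))

/-- the print-priced shape is nonnegative (`Kz, σ, Λ′ ≥ 0`) [folklore] -/
theorem pshape_nonneg (hKz : 0 ≤ Kz) (hσ : 0 ≤ σ) (hΛ : 0 ≤ Λ') (R : ℕ → ℕ) (g : ℕ → ℝ) (κ : Gen PEv → ℕ → ℝ)
    (G : Gen PEv) : 0 ≤ pshape O C Kz p σ Λ' R g κ G :=
  mul_nonneg (prefactor_nonneg hKz hσ hΛ p G) (by positivity)

/-- **PRINT-PRICED SHAPE ≤ MODEL SHAPE** under `Dominates`, whenever the realised per-step cost is read below the model's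
`cost` on the life (`Dominates.shape_le_shapeZ`, restated for `pshape`). [folklore] -/
theorem Dominates.pshape_le_shapeZ (hD : Dominates C O) (hKz : 1 ≤ Kz) (hσ : 0 ≤ σ) (hΛ : 0 ≤ Λ')
    (R : ℕ → ℕ → ℕ) (g : ℕ → ℕ → ℝ) (K : ℕ) {κ : Gen PEv → ℕ → ℝ} {G : Gen PEv}
    (h : ∀ n ∈ life (dictW (R K) C.n₁) G, κ G n ≤ cost C K (R K) G n) :
    pshape O C Kz p σ Λ' (R K) (g K) κ G ≤ shapeZ C Kz p σ Λ' R g K G :=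
  hD.shape_le_shapeZ hKz hσ hΛ R g K h

/-- **THE PRODUCT STEP** (the `price`∕`price'` fields of either socket at `C`): a class price below a product of
print-priced shapes — over any finite family of live structures `q`, genealogy `gen q`, each with its realised cost read
below the model's — is below the product of the model's labelled shapes. [folklore] -/
theorem Dominates.le_prod_shapeZ (hD : Dominates C O) (hKz : 1 ≤ Kz) (hσ : 0 ≤ σ) (hΛ : 0 ≤ Λ')
    (R : ℕ → ℕ → ℕ) (g : ℕ → ℕ → ℝ) (K : ℕ) {ι : Type*} (S : Finset ι) (gen : ι → Gen PEv)
    (κ : ι → Gen PEv → ℕ → ℝ) (h : ∀ q ∈ S, ∀ n ∈ life (dictW (R K) C.n₁) (gen q), κ q (gen q) n ≤ cost C K (R K) (gen q) n)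
    {x : ℝ} (hx : x ≤ ∏ q ∈ S, pshape O C Kz p σ Λ' (R K) (g K) (κ q) (gen q)) :
    x ≤ ∏ q ∈ S, shapeZ C Kz p σ Λ' R g K (gen q) :=
  hx.trans (prod_le_prod (fun _ _ => pshape_nonneg (zero_le_one.trans hKz) hσ hΛ _ _ _ _)
    fun q hq => hD.pshape_le_shapeZ hKz hσ hΛ R g K (h q hq))

end Product

/-! ## §4 Sanity: the toy pair of `HistoryConstants` -/

namespace Sanity

/-- the print-shaped record of the toy `O₁` over the toy `C₁` is dominated-refined by `C₁` [folklore] -/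
example : Refines C₁ (printedConsts O₁ C₁) := dominates_C₁_O₁.refines_printedConsts O₁_pos (by norm_num [C₁])

/-- and is itself print-shaped and valid (`fatWait 2 = 1 ≤ n₁ = 2`) [folklore] -/
example : Dominates (printedConsts O₁ C₁) O₁ ∧ (printedConsts O₁ C₁).Valid :=
  ⟨dominates_printedConsts C₁ O₁_pos,
    printedConsts_valid C₁ O₁_pos (by norm_num [C₁]) (by norm_num [C₁]) (by norm_num [C₁]) (by norm_num [C₁])
      (by decide)⟩

end Sanity

end

end Summit.QuantumFields.BalabanUV.T4Continuum.HistoryConstants
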